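import Summits.Ventures.Crystal3D.Theorems.StickyWulffConstantGenericWallFloorP5Exhaustion
import Summits.Ventures.Crystal3D.Theorems.StickyWulffConstantGenericWallFloorOfCore
import HarnessLib

/-!
# E1 in CERTIFIED NORMAL FORM, part 2: `P5Exhaustion → ExactOnly`, and the crux `GenericWallFloor` from
# `{P5Exhaustion, StarPairFar, GenericWallFloorCore}` (stmt-Ventures-19480, line `WallLedgerG`)

HONEST FRAMING. Venture `Summits/Ventures/Crystal3D` (cell `crystal3d-full`), helper `--supports` the crux
`GenericWallFloor` of `route-Ventures-StickyWulffConstant`, REGISTERED line `WallLedgerG`, open stub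
`stub_twoSlabAdhesion`.  Rung credit only; F-C1 not moved; NOT the crux.

Sequel of `…GenericWallFloorP5Exhaustion` (the named computational hypothesis `P5Exhaustion` = the outside-tube half
of the E1 row P₅ in the kernel's tube currency).  Here the kernel consequence:

* identifications `image_s_cert_C12_55` (`{cert_C12_55.s i} = p5SpecFcc`), `image_s_cert_A12_451_isoA/B`
  (`p5IsoA/B {cert_A12_451.s i} = p5SpecTwinA/B`), the active own balls of both certificates (moved) lie in `p5Own`,
  and `p5Own ∪ p5SpecFcc = fccKissingPattern`, `p5Own ∪ p5SpecTwinA/B = p5IsoA/B '' hcpKissingPattern` — all from the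
  single integer table `p5_tables`;
* **`exactOnly_p5Own_of_exhaustion : P5Exhaustion → ExactOnly 0 p5Own`** — by `sdiff_eq_of_coneCert` with the LANDED
  per-ball tube theorems (`cert_C12_55_rhoAt_*`, `cert_A12_451_rhoAt_*`, `ConeCert.eq_slotSet_of_slotMatched`) the
  free part of a kissing completion IS the special completion it is matched to, and each closes `p5Own` up to a
  close-packed dozen;
* `filter_star_p5Centre_eq` — `p5Own` is the closed vertex star of `(−1,−1,0)/√2` in the cuboctahedron, so
  **`exactOnly_star_of_p5Exhaustion : P5Exhaustion → ∃ s₀ ∈ fccSlots, ExactOnly 0 (star s₀)`**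
  (`exactOnly_star_of_cubic`, `…StarTransport`) — verbatim the hypothesis `hcert` of every stack / chain / word ledger
  of lanes G, F, T;
* **`genericWallFloor_of_core_p5 : P5Exhaustion → StarPairFar → GenericWallFloorCore → GenericWallFloor`** — the crux
  BY NAME from its debt in certified normal form: two certified computations (cf-p2 R38 §34.R2; lit g13 / wulff-p2
  g10) and the typed residual of `…GenericWallFloorOfCore`.

WHAT THIS IS NOT: `P5Exhaustion` and `StarPairFar` are certified computations, not kernel proofs; `GenericWallFloorCore`
(the ray-aligned chain core) is open; F-C1 not moved.
-/

noncomputable section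

namespace Summit.Ventures.Crystal3D.Theorems

open Finset Literature.Geometry.DiscreteGeometry
open scoped RealInnerProductSpace

/-! ### Identifications with the certificates' slot sets; close packing of the three completions -/

/-- Scaled patterns of a union. -/
theorem scaledPattern_union (A B : Finset (Fin 3 → ℤ)) (N : ℕ) :
    scaledPattern (A ∪ B) N = scaledPattern A N ∪ scaledPattern B N := by
  classical
  unfold scaledPattern; rw [Finset.image_union]

/-- Scaled patterns are monotone. -/
theorem scaledPattern_mono {A B : Finset (Fin 3 → ℤ)} (h : A ⊆ B) (N : ℕ) :
    scaledPattern A N ⊆ scaledPattern B N := by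
  classical
  unfold scaledPattern; exact Finset.image_subset_image h

/-- The cuboctahedral free part is the slot set of `cert_C12_55`. -/
theorem image_s_cert_C12_55 : Finset.univ.image cert_C12_55.s = p5SpecFcc := by
  rw [ConeCert.image_s_eq_scaledPattern, p5_tables.1]; rfl

/-- The active own balls of `cert_C12_55` lie in the P₅ own pattern. -/
theorem ownSet_cert_C12_55_subset : cert_C12_55.ownSet ⊆ p5Own := by
  rw [ConeCert.ownSet_eq_scaledPattern]
  exact scaledPattern_mono p5_tables.2.1 _

/-- The first twin free part is the `p5IsoA`-image of the slot set of `cert_A12_451`. -/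
theorem image_s_cert_A12_451_isoA : (Finset.univ.image cert_A12_451.s).image p5IsoA = p5SpecTwinA := by
  rw [ConeCert.image_s_eq_scaledPattern, image_scaledPattern_of_intMap p5IsoA p5IsoAInt p5IsoA_intVec,
    p5_tables.2.2.2.1]; rfl

/-- The second twin free part is the `p5IsoB`-image of the slot set of `cert_A12_451`. -/
theorem image_s_cert_A12_451_isoB : (Finset.univ.image cert_A12_451.s).image p5IsoB = p5SpecTwinB := by
  rw [ConeCert.image_s_eq_scaledPattern, image_scaledPattern_of_intMap p5IsoB p5IsoBInt p5IsoB_intVec,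
    p5_tables.2.2.2.2.1]; rfl

/-- The active own balls of `cert_A12_451`, moved by `p5IsoA`, lie in the P₅ own pattern. -/
theorem ownSet_cert_A12_451_isoA_subset : cert_A12_451.ownSet.image p5IsoA ⊆ p5Own := by
  rw [ConeCert.ownSet_eq_scaledPattern, image_scaledPattern_of_intMap p5IsoA p5IsoAInt p5IsoA_intVec, p5Own,
    ← scaledPattern_image_three p5OwnInt]
  exact scaledPattern_mono p5_tables.2.2.2.2.2.1 _

/-- The active own balls of `cert_A12_451`, moved by `p5IsoB`, lie in the P₅ own pattern. -/
theorem ownSet_cert_A12_451_isoB_subset : cert_A12_451.ownSet.image p5IsoB ⊆ p5Own := by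
  rw [ConeCert.ownSet_eq_scaledPattern, image_scaledPattern_of_intMap p5IsoB p5IsoBInt p5IsoB_intVec, p5Own,
    ← scaledPattern_image_three p5OwnInt]
  exact scaledPattern_mono p5_tables.2.2.2.2.2.2.1 _

/-- `O ∪ S_fcc` is the cuboctahedron. -/
theorem p5Own_union_fcc : p5Own ∪ p5SpecFcc = fccKissingPattern := by
  rw [p5Own, p5SpecFcc, ← scaledPattern_union, p5_tables.2.2.1]; rfl

/-- `O ∪ S_twinA` is the `p5IsoA`-image of the anticuboctahedron. -/
theorem p5Own_union_twinA : p5Own ∪ p5SpecTwinA = hcpKissingPattern.image p5IsoA := by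
  rw [hcpKissingPattern, image_scaledPattern_of_intMap p5IsoA p5IsoAInt p5IsoA_intVec, p5_tables.2.2.2.2.2.2.2.1,
    scaledPattern_union, scaledPattern_image_three]; rfl

/-- `O ∪ S_twinB` is the `p5IsoB`-image of the anticuboctahedron. -/
theorem p5Own_union_twinB : p5Own ∪ p5SpecTwinB = hcpKissingPattern.image p5IsoB := by
  rw [hcpKissingPattern, image_scaledPattern_of_intMap p5IsoB p5IsoBInt p5IsoB_intVec, p5_tables.2.2.2.2.2.2.2.2.1,
    scaledPattern_union, scaledPattern_image_three]; rfl

/-- The image of the anticuboctahedron under a linear isometry is a close-packed dozen at the origin. -/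
theorem isClosePackedDozenAt_zero_image_hcp (L : EuclideanSpace ℝ (Fin 3) ≃ₗᵢ[ℝ] EuclideanSpace ℝ (Fin 3)) :
    IsClosePackedDozenAt 0 (hcpKissingPattern.image L) := by
  refine ⟨L.toLinearIsometry, Or.inr ?_⟩
  rw [Finset.coe_image]
  exact Set.image_congr fun x _ => by simp

/-- The cuboctahedron is a close-packed dozen at the origin. -/
theorem isClosePackedDozenAt_zero_fcc : IsClosePackedDozenAt 0 fccKissingPattern := by
  refine ⟨LinearIsometry.id, Or.inl ?_⟩
  ext x; simp

/-! ### The landed per-ball radii, collected, and the radius functions on their slots -/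

/-- The landed per-ball checks of `cert_C12_55`, collected. -/
theorem cert_C12_55_rhoAt_all : ∀ i, cert_C12_55.rhoCheckAt i (p5RhoFcc i) 1000 = true := by
  intro i
  fin_cases i
  exacts [cert_C12_55_rhoAt_0, cert_C12_55_rhoAt_1, cert_C12_55_rhoAt_2, cert_C12_55_rhoAt_3,
    cert_C12_55_rhoAt_4, cert_C12_55_rhoAt_5, cert_C12_55_rhoAt_6]

/-- The landed per-ball checks of `cert_A12_451`, collected. -/
theorem cert_A12_451_rhoAt_all : ∀ i, cert_A12_451.rhoCheckAt i (p5RhoHcp i) 1000 = true := by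
  intro i
  fin_cases i
  exacts [cert_A12_451_rhoAt_0, cert_A12_451_rhoAt_1, cert_A12_451_rhoAt_2, cert_A12_451_rhoAt_3,
    cert_A12_451_rhoAt_4, cert_A12_451_rhoAt_5, cert_A12_451_rhoAt_6]

/-- `p5RadFcc` at the slots of `cert_C12_55`. -/
theorem p5RadFcc_s (i : Fin 7) : p5RadFcc (cert_C12_55.s i) = (p5RhoFcc i : ℝ) / 1000 := by
  classical
  have hsinj : Function.Injective cert_C12_55.s := cert_C12_55.s_injective cert_C12_55_valid cert_C12_55_slotInj
  rw [p5RadFcc, Finset.sum_eq_single i (fun j _ hj => if_neg fun h => hj (hsinj h).symm) (by simp), if_pos rfl]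

/-- `p5RadTwinA` at the transported slots of `cert_A12_451`. -/
theorem p5RadTwinA_s (i : Fin 7) : p5RadTwinA (p5IsoA (cert_A12_451.s i)) = (p5RhoHcp i : ℝ) / 1000 := by
  classical
  have hsinj : Function.Injective fun i => p5IsoA (cert_A12_451.s i) :=
    p5IsoA.injective.comp (cert_A12_451.s_injective cert_A12_451_valid cert_A12_451_slotInj)
  rw [p5RadTwinA, Finset.sum_eq_single i (fun j _ hj => if_neg fun h => hj (hsinj h).symm) (by simp), if_pos rfl]

/-- `p5RadTwinB` at the transported slots of `cert_A12_451`. -/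
theorem p5RadTwinB_s (i : Fin 7) : p5RadTwinB (p5IsoB (cert_A12_451.s i)) = (p5RhoHcp i : ℝ) / 1000 := by
  classical
  have hsinj : Function.Injective fun i => p5IsoB (cert_A12_451.s i) :=
    p5IsoB.injective.comp (cert_A12_451.s_injective cert_A12_451_valid cert_A12_451_slotInj)
  rw [p5RadTwinB, Finset.sum_eq_single i (fun j _ hj => if_neg fun h => hj (hsinj h).symm) (by simp), if_pos rfl]

/-! ### The kernel consequence: `ExactOnly` for the P₅ pattern -/

/-- **`P5Exhaustion` ⇒ the P₅ own pattern is exact-only.**  The three transported tube theorems (landed cone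
certificates with per-ball radii) identify the free part of any kissing completion with the special completion it is
matched to; each special completion closes `p5Own` up to a close-packed dozen. -/
theorem exactOnly_p5Own_of_exhaustion (h : P5Exhaustion) : ExactOnly 0 p5Own := by
  classical
  intro N hON hcard hk
  rcases h N hON hcard hk with hm | hm | hm
  · have hfree : N \ p5Own = p5SpecFcc := by
      have hm' : SlotMatched p5RadFcc (N \ p5Own)
          ((Finset.univ.image cert_C12_55.s).image (LinearIsometryEquiv.refl ℝ (EuclideanSpace ℝ (Fin 3)))) := by
        rwa [LinearIsometryEquiv.coe_refl, Finset.image_id, image_s_cert_C12_55]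
      have hown : cert_C12_55.ownSet.image (LinearIsometryEquiv.refl ℝ (EuclideanSpace ℝ (Fin 3))) ⊆ p5Own := by
        rw [LinearIsometryEquiv.coe_refl, Finset.image_id]; exact ownSet_cert_C12_55_subset
      have hρle : ∀ i, p5RadFcc ((LinearIsometryEquiv.refl ℝ (EuclideanSpace ℝ (Fin 3))) (cert_C12_55.s i)) ≤
          (p5RhoFcc i : ℝ) / (1000 : ℕ) := fun i => by
        rw [LinearIsometryEquiv.coe_refl, id, p5RadFcc_s, Nat.cast_ofNat]
      have := sdiff_eq_of_coneCert cert_C12_55 cert_C12_55_valid cert_C12_55_rhoAt_all cert_C12_55_slotInj _ hρle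
        hown hON hk hm'
      rwa [LinearIsometryEquiv.coe_refl, Finset.image_id, image_s_cert_C12_55] at this
    have hN : N = p5Own ∪ p5SpecFcc := by rw [← hfree, Finset.union_sdiff_of_subset hON]
    rw [hN, p5Own_union_fcc]
    exact isClosePackedDozenAt_zero_fcc
  · have hfree : N \ p5Own = p5SpecTwinA := by
      have hm' : SlotMatched p5RadTwinA (N \ p5Own) ((Finset.univ.image cert_A12_451.s).image p5IsoA) := by
        rwa [image_s_cert_A12_451_isoA]
      have hρle : ∀ i, p5RadTwinA (p5IsoA (cert_A12_451.s i)) ≤ (p5RhoHcp i : ℝ) / (1000 : ℕ) := fun i => by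
        rw [p5RadTwinA_s, Nat.cast_ofNat]
      have := sdiff_eq_of_coneCert cert_A12_451 cert_A12_451_valid cert_A12_451_rhoAt_all cert_A12_451_slotInj
        p5IsoA hρle ownSet_cert_A12_451_isoA_subset hON hk hm'
      rwa [image_s_cert_A12_451_isoA] at this
    have hN : N = p5Own ∪ p5SpecTwinA := by rw [← hfree, Finset.union_sdiff_of_subset hON]
    rw [hN, p5Own_union_twinA]
    exact isClosePackedDozenAt_zero_image_hcp p5IsoA
  · have hfree : N \ p5Own = p5SpecTwinB := by
      have hm' : SlotMatched p5RadTwinB (N \ p5Own) ((Finset.univ.image cert_A12_451.s).image p5IsoB) := by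
        rwa [image_s_cert_A12_451_isoB]
      have hρle : ∀ i, p5RadTwinB (p5IsoB (cert_A12_451.s i)) ≤ (p5RhoHcp i : ℝ) / (1000 : ℕ) := fun i => by
        rw [p5RadTwinB_s, Nat.cast_ofNat]
      have := sdiff_eq_of_coneCert cert_A12_451 cert_A12_451_valid cert_A12_451_rhoAt_all cert_A12_451_slotInj
        p5IsoB hρle ownSet_cert_A12_451_isoB_subset hON hk hm'
      rwa [image_s_cert_A12_451_isoB] at this
    have hN : N = p5Own ∪ p5SpecTwinB := by rw [← hfree, Finset.union_sdiff_of_subset hON]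
    rw [hN, p5Own_union_twinB]
    exact isClosePackedDozenAt_zero_image_hcp p5IsoB

/-! ### From the P₅ pattern to the ledgers' `ExactOnly` hypothesis and to the crux -/

/-- The centre of the P₅ star, `(−1,−1,0)/√2`, is a vector of the cuboctahedron. -/
theorem p5Centre_mem : (Real.sqrt ((2 : ℕ) : ℝ))⁻¹ • intVec ![-1, -1, 0] ∈ fccKissingPattern :=
  Finset.mem_image.2 ⟨![-1, -1, 0], p5_tables.2.2.2.2.2.2.2.2.2.2, rfl⟩

/-- The closed vertex star of the centre `(−1,−1,0)/√2` in the cuboctahedron (the own-pattern shape of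
`exactOnly_star_of_cubic`) IS the P₅ own pattern. -/
theorem filter_star_p5Centre_eq :
    fccKissingPattern.filter (fun p => 0 < ⟪p, (Real.sqrt ((2 : ℕ) : ℝ))⁻¹ • intVec ![-1, -1, 0]⟫) = p5Own := by
  classical
  have hc : (0 : ℝ) < (Real.sqrt ((2 : ℕ) : ℝ))⁻¹ := by positivity
  unfold fccKissingPattern p5Own scaledPattern
  rw [Finset.filter_image, ← p5_tables.2.2.2.2.2.2.2.2.2.1]
  congr 1
  refine Finset.filter_congr fun v _ => ?_
  show 0 < ⟪(Real.sqrt ((2 : ℕ) : ℝ))⁻¹ • intVec v, (Real.sqrt ((2 : ℕ) : ℝ))⁻¹ • intVec ![-1, -1, 0]⟫ ↔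
    0 < dotInt v ![-1, -1, 0]
  rw [real_inner_smul_left, real_inner_smul_right, inner_intVec, mul_pos_iff_of_pos_left hc,
    mul_pos_iff_of_pos_left hc, Int.cast_pos]

/-- **E1 for the ledgers, from the certified normal form**: `P5Exhaustion` gives the `ExactOnly` row C12-55 in the
venture's slot vocabulary (some slot `s₀` and its closed vertex star) — verbatim the hypothesis `hcert` of every
stack / chain / word ledger of lanes G, F, T (then `exactOnly_star_transport` moves it to any frame, centre, slot). -/
theorem exactOnly_star_of_p5Exhaustion (h : P5Exhaustion) :
    ∃ s₀ ∈ fccSlots, ExactOnly 0 (fccSlots.filter fun w => 0 < ⟪w, s₀⟫) :=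
  exactOnly_star_of_cubic p5Centre_mem (by rw [filter_star_p5Centre_eq]; exact exactOnly_p5Own_of_exhaustion h)

/-- **The crux `GenericWallFloor` BY NAME from its debt in certified normal form**: the two certified computations
`P5Exhaustion` (E1; cf-p2 R38) and `StarPairFar` (lit g13 / wulff-p2 g10), and the typed residual
`GenericWallFloorCore` (`…GenericWallFloorOfCore`). -/
theorem genericWallFloor_of_core_p5 (hE1 : P5Exhaustion) (hfar : StarPairFar) (hcore : GenericWallFloorCore) :
    Summit.Ventures.Crystal3D.Theses.StickyWulffConstant.GenericWallFloor := by
  obtain ⟨s₀, hs₀, hcert⟩ := exactOnly_star_of_p5Exhaustion hE1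
  exact genericWallFloor_of_core hs₀ hcert hfar hcore

end Summit.Ventures.Crystal3D.Theorems

end
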